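import Summits.Ventures.CertifiedManyBodySolver.Theses.CovLa214M2b
import Summits.Ventures.CertifiedManyBodySolver.Downfold.BoxesLa214V115M2bLeftStem
import HarnessLib

/-!
# Crux `CovLa214M2b.TransportFanCeiling` (stmt-Ventures-26184) — SKELETON LINE «foot» (insurance line (b) of LA214-COVERAGE-PLAN v1.8.1 §0.8 (5) T2)

Route pen hubbard-m2-certneg-1 (planner, cell `pub/hubbard-obs`). The crux K2 = the TRANSPORT-FAN shadow of the La214-E box
`[−3/10, −1/5] × [29/5, 74/5] × {1}`: every target `(t′, U)` whose apex source at the f-sum station `U = 29/5` LEAVES the box through the left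
edge, `t′(2 − (29/5)/U) ≤ −3/10`, carries `ObsStiffnessSeqCeilingAt t′ U 1 (4364687/10⁷)`.

LINE OF RECORD (director crux №2 «the t′ ≠ 0 U-ray transport»; downfold-unc-2 LEFT-STEM / POCKET-39o5 typing `Downfold/BoxesLa214V115M2bLeftStem`,
`…KinematicSlab11o40`): the slab `t′ ≥ −11/40` is node-free kinematics; for `U ≥ 39/5` the strip `t′ ∈ [−3/10, −11/40]` is worded by POINT tiles already
certified as claim nodes (L3 overhang slot O1–O9, C3 station-8 G1 + its `K₂` ceiling, B5 far-vertex wedge); what remains of K2 is the pocket's K2 side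
`{t′ ≤ −11/40, U < 39/5, source ≤ −3/10}`, which ONE own-word `U`-RAY on the in-box left-edge foot `{t′ = −3/10} × [29/5, 39/5]` words by transport ABOVE
the station along the line `t′ = −3/10` (stem source height `U(2 + (3/10)/t′) ∈ [29/5, U]`). Hence TWO stubs, two producers:

* `stub_leftEdgeFootRay_underBar` — the producer deliverable: an unconditional own-word orbit-lower `U`-family `valL` on the foot, priced
  `−valL ≤ 4364687/10⁷` (its two vertices are certified words already: B2 j298764 at `U = 29/5` (0.3870869), C3 j299520 at `U = 8` (0.3179617); the
  `U`-segment read between them is NEW; its window law is the `t′`-bundle's (CORRECTED per downfold-unc-2 g17, p625499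
  `Downfold.BoxesLa214V115M2bLeftStemCells`: `e₀` IS concave AND non-decreasing in `U` ⇒ FLOOR = chord of the vertex floors, CAP = the top
  vertex's cap, `la214E_stemCell_energy_le_top`; cap-discharged cell closers `TransportFanCeiling_of_leftEdgeFootCell8` / `…Cells6_8`));
* `stub_highUPointCover` — the node-discharge piece: the bar-word on the high-`U` strip `[−3/10, −11/40] × [39/5, 74/5]` (in tree only modulo the ten
  claim nodes j300345/j295983/j299520/#472/#428/j298996/#21/#487/#427/#488: `la214E_strip_cover_39o5_961o100`, the far-vertex wedge, tile G1);
* `TransportFanCeiling_of` — the kernel-checked composition (kinematic slab ∪ foot ray ∪ point cover), concluding the route decl BY NAME.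

HONEST FRAMING: a skeleton, not a proof — the two `stub_*` carry `sorry` by design; stiffness CEILINGS on a downfolded box = CONTROL/CALIBRATION +
labelled heuristic, silent on `ρ_s = 0`, never «certified true negative»; no number of record, no certificate, no phase sentence; no summit
statement is proved by this seat.
-/

noncomputable section

namespace Summit.Ventures.CertifiedManyBodySolver.Cruxes.TransportFanCeiling.Foot

open Set Filter Topology
open Summit.Ventures.CertifiedManyBodySolver.Theses.CovLa214M2b
open Summit.Ventures.CertifiedManyBodySolver.Observables
open Summit.Ventures.CertifiedManyBodySolver.Downfold
open Literature.MathematicalPhysics.QuantumLattice Literature.MathematicalPhysics.QuantumLattice.ThermodynamicLimit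
open Literature.Probability.LatticeModels
open Matrix HubbardWave0
open scoped BigOperators ComplexOrder

/-- **Stub 1 statement — ONE OWN-WORD `U`-RAY ON THE LEFT-EDGE FOOT `{t′ = −3/10} × [29/5, 39/5]` UNDER THE BAR**: some orbit-lower family `valL`
(for every `U′` of the foot and every torus limit `ω` of unit `(rectN 1 L, S^z = 0)`-sector ground states of `hubbardTorusTT' L 1 (−3/10) U′`, the
unconditional `D₄`-orbit-mean lower bound `valL U′ ≤ |D₄|⁻¹ Σ_γ Re ω_γ(Γ_γ(−X₀(−3/10; U′)))`), priced `−valL U′ ≤ 4364687/10⁷`.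
[cite: ScalapinoWhiteZhang1993, §II] [cite: BoydVandenberghe2004, §5.9] -/
def LeftEdgeFootRayUnderBar : Prop :=
  ∃ valL : ℝ → ℝ,
    (∀ U' ∈ Set.Icc (29 / 5 : ℝ) (39 / 5),
      ∀ (ω : InfVolFermionState 2) (Ls : ℕ → ℕ) (ψ : ∀ L, Fock (Orb (FermionTorus 2 L))),
      Tendsto Ls atTop atTop →
      (∀ j, IsGroundStateInSector (hubbardTorusTT' (Ls j) 1 (-3 / 10) U') (rectN 1 (Ls j)) 0 (ψ (Ls j))) →
      (∀ j, star (ψ (Ls j)) ⬝ᵥ ψ (Ls j) = 1) → ω.IsTorusLimitOf ψ Ls →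
      valL U' ≤ ((Finset.univ : Finset (DihedralGroup 4)).card : ℝ)⁻¹ * ∑ g ∈ (Finset.univ : Finset (DihedralGroup 4)),
        (ω.expect (d4ShiftSet g 0 (box 2 7)) (fermionEmbed (PolySite.d4Emb g 0 (box 2 7)) (-oddMomentObsTT (-3 / 10) U' 0))).re) ∧
    (∀ U' ∈ Set.Icc (29 / 5 : ℝ) (39 / 5), -valL U' ≤ ((4364687 / 10000000 : ℚ) : ℝ))

/-- **Stub 2 statement — THE HIGH-`U` POINT COVER**: the bar-word `ObsStiffnessSeqCeilingAt t′ U 1 (4364687/10⁷)` on the strip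
`t′ ∈ [−3/10, −11/40]`, `U ∈ [39/5, 74/5]` (overhang-slot points, station-8 tile, far-vertex wedge — each a certified claim node awaiting its
reader-B/referee legs). [cite: KomaTasaki1994, §1] [cite: ScalapinoWhiteZhang1993, §II] -/
def HighUPointCover : Prop :=
  ∀ tp ∈ Set.Icc (-3 / 10 : ℝ) (-11 / 40), ∀ U ∈ Set.Icc (39 / 5 : ℝ) (74 / 5), ObsStiffnessSeqCeilingAt tp U 1 (4364687 / 10000000)

/-- **STUB 1 (the producer deliverable; size L: a NEW `U`-segment read on `{−3/10} × [29/5, 39/5]` — the `U`-ray's own window law, the read, the claim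
node, reader-B/referee).** [cite: BoydVandenberghe2004, §5.9] -/
theorem stub_leftEdgeFootRay_underBar : LeftEdgeFootRayUnderBar := by
  sorry

/-- **STUB 2 (node discharge; size M: ten named claim nodes through their reader-B/referee legs, then `la214E_strip_cover_39o5_961o100` + wedge + G1
verbatim).** [cite: KomaTasaki1994, §1] -/
theorem stub_highUPointCover : HighUPointCover := by
  sorry

/-- **COMPOSITION (kernel-checked, no `sorry` of its own): foot ray + high-`U` point cover ⇒ `TransportFanCeiling`.** On the strip reduction
(`TransportFanCeiling_of_strip`): `t′ > −11/40` is the node-free kinematic slab; `t′ ≤ −11/40, U < 39/5` is the foot ray by transport above the station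
along `t′ = −3/10` (`la214E_pocketK2_stiffnessLeaf_bar_of_leftEdgeFoot`); `U ≥ 39/5` is the point cover. [cite: KomaTasaki1994, §1] [cite: ScalapinoWhiteZhang1993, §II] -/
theorem TransportFanCeiling_of (hF : LeftEdgeFootRayUnderBar) (hP : HighUPointCover) :
    Summit.Ventures.CertifiedManyBodySolver.Theses.CovLa214M2b.TransportFanCeiling := by
  obtain ⟨valL, hL, hcL⟩ := hF
  refine TransportFanCeiling_of_strip fun tp htp U hU hs => ?_
  have hU0 : U ≠ 0 := ne_of_gt (by linarith [hU.1])
  have hse : tp * (2 - 29 / 5 / U) = tp * (2 * U - 29 / 5) / U := by field_simp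
  rw [hse] at hs
  rcases lt_or_ge (-11 / 40 : ℝ) tp with hk | hk
  · exact la214E_n1_kinSlab11o40_stiffnessLeaf_bar ⟨hk.le, by linarith [htp.2]⟩ zero_le_one le_rfl
  rcases lt_or_ge U (39 / 5) with hUb | hUb
  · exact la214E_pocketK2_stiffnessLeaf_bar_of_leftEdgeFoot valL hL hcL tp ⟨htp.1, hk⟩ U hU hUb hs
  · exact hP tp ⟨htp.1, hk⟩ U ⟨hUb, hU.2⟩

/-- The skeleton decides the crux from its two stubs (the line's shape, for the record). -/
theorem TransportFanCeiling_of_stubs : Summit.Ventures.CertifiedManyBodySolver.Theses.CovLa214M2b.TransportFanCeiling :=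
  TransportFanCeiling_of stub_leftEdgeFootRay_underBar stub_highUPointCover

end Summit.Ventures.CertifiedManyBodySolver.Cruxes.TransportFanCeiling.Foot

end
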